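import Literature.MathematicalPhysics.QuantumLattice.KohnLuttingerRadialProjection
import Literature.Analysis.FunctionSpaces.MinkowskiIntegral
import Mathlib.Analysis.SpecialFunctions.Pow.Integral
import Mathlib.Analysis.SpecialFunctions.ImproperIntegrals
import HarnessLib

/-!
# `L²` bound for the Lindhard kernel along the Fermi curve (Minkowski route)

Topic `Literature/MathematicalPhysics/QuantumLattice`. For `ε = squareDispersion 1 0`, `-4 < μ < 0`,
`γ = fermiPolar μ`, the polar Lindhard kernel `K_μ(θ, θ') = χ₀(γθ + γθ'; μ)`,
`χ₀ = lindhardFunction ε μ = (2π)⁻² ∫_{BZ} F(q, p) dp`, is shown to lie in `L²(dθ dθ' ⌞ (-π,π]²)`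
GIVEN two geometric inputs (taken as hypotheses here, proved elsewhere):

* (TSL) a torus sublevel estimate `λ²{(θ,θ') : |ε(p + γθ + γθ') - μ| < s} ≤ C s^β` (`β > 0`),
  uniformly in `p`;
* (SV) a shell-volume estimate `vol(BZ ∩ {|ε - μ| < t}) ≤ C_sh t`.

Route (Stein's Minkowski integral inequality, tree file `Literature.Analysis.FunctionSpaces.MinkowskiIntegral`):
`‖K_μ‖_{L²} ≤ (2π)⁻² ∫_{BZ} ‖F(γθ+γθ', p)‖_{L²(dθdθ')} dp`, and pointwise
`F(q,p) ≤ (|ε_p - μ| + |ε_{p+q} - μ|)⁻¹` (`lindhardIntegrand_le_inv`), so by the layer-cake formula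
and (TSL) `‖F(·, p)‖_{L²} ≤ C' |ε_p - μ|^{β/2-1}` (`eLpNorm_lindhardIntegrand_polar_le`), which is
`dp`-integrable over `BZ` by (SV) (`lintegral_rpow_neg_energy_lt_top`):

* `lintegral_inv_add_sq_le` — abstract layer cake: `∫ (a + X)⁻² dν ≤ (2C/(2-β)) a^{β-2}` when
  `ν{X < s} ≤ C s^β`;
* `memLp_lindhardKernelPolar` — **(K1') `K_μ ∈ L²(dθ dθ')`** from (TSL), (SV).

Everything is proved; no definitions. [cite: SteinSingularIntegrals1970, App. A.1]
-/

noncomputable section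

open Real Set Filter MeasureTheory MeasureTheory.Measure
open scoped Topology ENNReal NNReal

namespace Literature.MathematicalPhysics.QuantumLattice

/-! ### A layer-cake bound -/

/-- **Layer cake**: if `X ≥ 0` has sublevel measures `ν{X < s} ≤ C s^β` (`0 < β < 2`) then for
`a > 0`, `∫ ((a + X)⁻¹)² dν ≤ (2C/(2-β)) · a^{β-2}` (the function `Y = (a+X)⁻¹ ≤ a⁻¹` has
`ν{t < Y} ≤ ν{X < t⁻¹} ≤ C t^{-β}` for `t < a⁻¹` and `0` beyond). [folklore] -/
theorem lintegral_inv_add_sq_le {Z : Type*} [MeasurableSpace Z] (ν : Measure Z) {X : Z → ℝ}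
    (hX0 : ∀ z, 0 ≤ X z) (hXm : Measurable X) {C β : ℝ} (hC : 0 ≤ C) (hβ2 : β < 2)
    (hsub : ∀ s : ℝ, 0 < s → ν {z | X z < s} ≤ ENNReal.ofReal (C * s ^ β)) {a : ℝ} (ha : 0 < a) :
    ∫⁻ z, ENNReal.ofReal (((a + X z)⁻¹) ^ 2) ∂ν ≤ ENNReal.ofReal (2 * C / (2 - β) * a ^ (β - 2)) := by
  set Y : Z → ℝ := fun z => (a + X z)⁻¹ with hY
  have hY0 : ∀ z, 0 ≤ Y z := fun z => inv_nonneg.2 (by linarith [hX0 z])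
  have hYle : ∀ z, Y z ≤ a⁻¹ := fun z => by
    rw [hY]; exact inv_anti₀ ha (by linarith [hX0 z])
  have hYm : Measurable Y := (measurable_const.add hXm).inv
  -- layer cake with exponent `2`
  have hlc := lintegral_rpow_eq_lintegral_meas_lt_mul ν (Eventually.of_forall hY0) hYm.aemeasurable
    (p := 2) two_pos
  have hrpow : (fun z => ENNReal.ofReal (Y z ^ (2 : ℝ))) = fun z => ENNReal.ofReal (((a + X z)⁻¹) ^ 2) := by
    funext z; rw [Real.rpow_two]
  rw [hrpow] at hlc
  rw [hlc]
  -- bound the `t`-integrand by `C t^{1-β}` on `(0, a⁻¹)` and by `0` beyond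
  have hbound : ∀ t ∈ Ioi (0 : ℝ), ν {z | t < Y z} * ENNReal.ofReal (t ^ ((2 : ℝ) - 1)) ≤
      (Ioo (0 : ℝ) a⁻¹).indicator (fun t => ENNReal.ofReal (C * t ^ (1 - β))) t := by
    intro t ht
    have ht0 : (0 : ℝ) < t := ht
    by_cases hta : t < a⁻¹
    · rw [indicator_of_mem (show t ∈ Ioo (0 : ℝ) a⁻¹ from ⟨ht0, hta⟩)]
      have hsubset : {z | t < Y z} ⊆ {z | X z < t⁻¹} := fun z (hz : t < Y z) => by
        show X z < t⁻¹
        have h1 : t < (a + X z)⁻¹ := hz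
        have h2 : a + X z < t⁻¹ := by
          rw [lt_inv_comm₀ (by linarith [hX0 z]) ht0]; exact h1
        linarith
      calc ν {z | t < Y z} * ENNReal.ofReal (t ^ ((2 : ℝ) - 1))
          ≤ ENNReal.ofReal (C * (t⁻¹) ^ β) * ENNReal.ofReal (t ^ ((2 : ℝ) - 1)) :=
            mul_le_mul_left ((measure_mono hsubset).trans (hsub _ (inv_pos.2 ht0))) _
        _ = ENNReal.ofReal (C * t ^ (1 - β)) := by
            rw [← ENNReal.ofReal_mul (by positivity)]
            congr 1
            rw [show (2 : ℝ) - 1 = 1 by norm_num, Real.rpow_one, Real.inv_rpow ht0.le, ← Real.rpow_neg ht0.le,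
              mul_assoc, ← Real.rpow_add_one ht0.ne']
            congr 2; ring
    · rw [indicator_of_notMem (fun h : t ∈ Ioo (0 : ℝ) a⁻¹ => hta h.2)]
      have hempty : {z | t < Y z} = ∅ := by
        ext z
        simp only [mem_setOf_eq, mem_empty_iff_false, iff_false, not_lt]
        exact (hYle z).trans (not_lt.1 hta)
      rw [hempty, measure_empty, zero_mul]
  have hint : IntegrableOn (fun t : ℝ => C * t ^ (1 - β)) (Ioo 0 a⁻¹) := by
    have h := (intervalIntegral.intervalIntegrable_rpow' (a := 0) (b := a⁻¹) (r := 1 - β) (by linarith)).1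
    have h' : IntegrableOn (fun t : ℝ => t ^ (1 - β)) (Ioo 0 a⁻¹) := h.mono_set Ioo_subset_Ioc_self
    exact h'.const_mul C
  calc ENNReal.ofReal 2 * ∫⁻ t in Ioi 0, ν {z | t < Y z} * ENNReal.ofReal (t ^ ((2 : ℝ) - 1))
      ≤ ENNReal.ofReal 2 * ∫⁻ t in Ioi 0, (Ioo (0 : ℝ) a⁻¹).indicator (fun t => ENNReal.ofReal (C * t ^ (1 - β))) t :=
        mul_le_mul_right (setLIntegral_mono' measurableSet_Ioi hbound) _
    _ = ENNReal.ofReal 2 * ∫⁻ t in Ioo 0 a⁻¹, ENNReal.ofReal (C * t ^ (1 - β)) := by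
        congr 1
        rw [lintegral_indicator measurableSet_Ioo, Measure.restrict_restrict measurableSet_Ioo,
          inter_eq_left.2 (Ioo_subset_Ioi_self)]
    _ = ENNReal.ofReal 2 * ENNReal.ofReal (∫ t in Ioo 0 a⁻¹, C * t ^ (1 - β)) := by
        rw [ofReal_integral_eq_lintegral_ofReal hint]
        exact (ae_restrict_iff' measurableSet_Ioo).2 (Eventually.of_forall fun t ht => by
          have : 0 ≤ t ^ (1 - β) := Real.rpow_nonneg ht.1.le _
          positivity)
    _ = ENNReal.ofReal (2 * C / (2 - β) * a ^ (β - 2)) := by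
        rw [← ENNReal.ofReal_mul (by norm_num)]
        congr 1
        rw [integral_const_mul, ← integral_Ioc_eq_integral_Ioo, ← intervalIntegral.integral_of_le (inv_nonneg.2 ha.le),
          integral_rpow (Or.inl (by linarith))]
        rw [Real.zero_rpow (by linarith), sub_zero, Real.inv_rpow ha.le, ← Real.rpow_neg ha.le]
        rw [show -(1 - β + 1) = β - 2 by ring]
        field_simp
        ring

/-! ### The pointwise bound on the Lindhard integrand

`lindhardIntegrand_le_inv` (tree, `KohnLuttingerLindhardMeasurable`): `F(q,p) ≤ 1/(|ε_p-μ| + |ε_{p+q}-μ|)`. -/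

/-! ### The `L²(dθ dθ')` bound of a `p`-section of the Lindhard integrand from the torus sublevel estimate -/

section Polar

variable {μ : ℝ} (hμ₁ : -4 < μ) (hμ₂ : μ < 0)
include hμ₁ hμ₂

/-- The sum map `(θ, θ') ↦ γθ + γθ'` is continuous. [folklore] -/
theorem continuous_fermiPolar_sum : Continuous fun z : ℝ × ℝ => fermiPolar μ z.1 + fermiPolar μ z.2 :=
  ((continuous_fermiPolar hμ₁ hμ₂).comp continuous_fst).add ((continuous_fermiPolar hμ₁ hμ₂).comp continuous_snd)

/-- The Lindhard integrand along the sum map is jointly measurable in `((θ,θ'), p)`. [folklore] -/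
theorem measurable_lindhardIntegrand_polar :
    Measurable fun x : (ℝ × ℝ) × Momentum =>
      lindhardIntegrand (squareDispersion 1 0) μ (fermiPolar μ x.1.1 + fermiPolar μ x.1.2) x.2 := by
  have hS : Measurable fun x : (ℝ × ℝ) × Momentum => (fermiPolar μ x.1.1 + fermiPolar μ x.1.2, x.2) :=
    ((continuous_fermiPolar_sum hμ₁ hμ₂).measurable.comp measurable_fst).prodMk measurable_snd
  have h := (measurable_lindhardIntegrand_uncurry (by unfold squareDispersion; fun_prop : Measurable (squareDispersion 1 0)) μ).comp hS
  exact h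

/-- **`‖F(γθ + γθ', p)‖_{L²(dθdθ')} ≤ √(2C/(2-β)) · |ε_p - μ|^{β/2-1}`** for `p` off the Fermi curve,
given the torus sublevel estimate at `(μ, p)`. [folklore] -/
theorem eLpNorm_lindhardIntegrand_polar_le (p : Momentum) {C β : ℝ} (hC : 0 ≤ C) (hβ2 : β < 2)
    (hTSL : ∀ s : ℝ, 0 < s →
      ((volume.restrict (Ioc (-π) π)).prod (volume.restrict (Ioc (-π) π)))
        {z : ℝ × ℝ | |squareDispersion 1 0 (p + (fermiPolar μ z.1 + fermiPolar μ z.2)) - μ| < s} ≤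
        ENNReal.ofReal (C * s ^ β))
    (hp : squareDispersion 1 0 p ≠ μ) :
    eLpNorm (fun z : ℝ × ℝ => lindhardIntegrand (squareDispersion 1 0) μ (fermiPolar μ z.1 + fermiPolar μ z.2) p) 2
        ((volume.restrict (Ioc (-π) π)).prod (volume.restrict (Ioc (-π) π))) ≤
      ENNReal.ofReal (Real.sqrt (2 * C / (2 - β)) * |squareDispersion 1 0 p - μ| ^ (β / 2 - 1)) := by
  set ν : Measure (ℝ × ℝ) := (volume.restrict (Ioc (-π) π)).prod (volume.restrict (Ioc (-π) π)) with hν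
  set a : ℝ := |squareDispersion 1 0 p - μ| with ha
  have ha0 : 0 < a := abs_pos.2 (sub_ne_zero.2 hp)
  set X : ℝ × ℝ → ℝ := fun z => |squareDispersion 1 0 (p + (fermiPolar μ z.1 + fermiPolar μ z.2)) - μ| with hX
  have hXm : Measurable X := by
    have hc : Continuous fun z : ℝ × ℝ => squareDispersion 1 0 (p + (fermiPolar μ z.1 + fermiPolar μ z.2)) := by
      have hε : Continuous (squareDispersion 1 0) := by unfold squareDispersion; fun_prop
      exact hε.comp (continuous_const.add (continuous_fermiPolar_sum hμ₁ hμ₂))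
    exact (hc.sub continuous_const).abs.measurable
  set F : ℝ × ℝ → ℝ := fun z => lindhardIntegrand (squareDispersion 1 0) μ (fermiPolar μ z.1 + fermiPolar μ z.2) p
    with hF
  have hF0 : ∀ z, 0 ≤ F z := fun z => lindhardIntegrand_nonneg _ _ _ _
  have hFle : ∀ z, F z ≤ (a + X z)⁻¹ := fun z => (lindhardIntegrand_le_inv _ _ _ _).trans_eq (one_div _)
  -- `eLpNorm F 2 = (∫ ‖F‖ₑ²)^{1/2}` and `‖F z‖ₑ² ≤ ofReal ((a+X)⁻²)`
  rw [eLpNorm_eq_lintegral_rpow_enorm_toReal two_ne_zero ENNReal.ofNat_ne_top, ENNReal.toReal_ofNat]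
  have hmono : ∫⁻ z, ‖F z‖ₑ ^ (2 : ℝ) ∂ν ≤ ∫⁻ z, ENNReal.ofReal (((a + X z)⁻¹) ^ 2) ∂ν := by
    refine lintegral_mono fun z => ?_
    rw [Real.enorm_eq_ofReal (hF0 z), ENNReal.ofReal_rpow_of_nonneg (hF0 z) (by norm_num), Real.rpow_two]
    exact ENNReal.ofReal_le_ofReal (pow_le_pow_left₀ (hF0 z) (hFle z) 2)
  have hlc := lintegral_inv_add_sq_le ν (fun z => abs_nonneg _) hXm hC hβ2 hTSL ha0
  have hK0 : 0 ≤ 2 * C / (2 - β) := div_nonneg (by positivity) (by linarith)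
  calc (∫⁻ z, ‖F z‖ₑ ^ (2 : ℝ) ∂ν) ^ (1 / (2 : ℝ))
      ≤ (ENNReal.ofReal (2 * C / (2 - β) * a ^ (β - 2))) ^ (1 / (2 : ℝ)) :=
        ENNReal.rpow_le_rpow (hmono.trans hlc) (by norm_num)
    _ = ENNReal.ofReal (Real.sqrt (2 * C / (2 - β)) * a ^ (β / 2 - 1)) := by
        rw [ENNReal.ofReal_rpow_of_nonneg (by positivity) (by norm_num)]
        congr 1
        rw [Real.mul_rpow hK0 (Real.rpow_nonneg ha0.le _), ← Real.sqrt_eq_rpow, ← Real.rpow_mul ha0.le]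
        congr 2; ring

end Polar

/-! ### Integrability of `|ε_p - μ|^{-γ}` over the Brillouin zone from the shell-volume estimate -/

/-- **`∫_{BZ} |ε_p - μ|^{-γ} dp ≤ vol(BZ) + C_sh/(γ⁻¹ - 1)`** for `0 < γ < 1`, given the shell-volume
estimate `vol(BZ ∩ {|ε - μ| < t}) ≤ C_sh t` (layer cake: the super-level sets of `|ε-μ|^{-γ}` are
shells of width `t^{-1/γ}`, and `∫₁^∞ t^{-1/γ} dt = (γ⁻¹ - 1)⁻¹`). The bound is UNIFORM in `μ`
(it only sees `C_sh`). [folklore] -/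
theorem lintegral_rpow_neg_energy_le {μ γ Csh : ℝ} (hγ0 : 0 < γ) (hγ1 : γ < 1) (hCsh : 0 ≤ Csh)
    (hSV : ∀ t : ℝ, 0 < t →
      volume (brillouinZone ∩ {p : Momentum | |squareDispersion 1 0 p - μ| < t}) ≤ ENNReal.ofReal (Csh * t)) :
    ∫⁻ p in brillouinZone, ENNReal.ofReal (|squareDispersion 1 0 p - μ| ^ (-γ)) ≤
      volume brillouinZone + ENNReal.ofReal (Csh * (γ⁻¹ - 1)⁻¹) := by
  set P : Measure Momentum := volume.restrict brillouinZone with hP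
  set f : Momentum → ℝ := fun p => |squareDispersion 1 0 p - μ| ^ (-γ) with hf
  have hf0 : ∀ p, 0 ≤ f p := fun p => Real.rpow_nonneg (abs_nonneg _) _
  have hε : Continuous (squareDispersion 1 0) := by unfold squareDispersion; fun_prop
  have ham : Measurable fun p : Momentum => |squareDispersion 1 0 p - μ| := (hε.sub continuous_const).abs.measurable
  have hfm : Measurable f := ham.pow_const _
  rw [lintegral_eq_lintegral_meas_lt P (Eventually.of_forall hf0) hfm.aemeasurable]
  -- `P{t < f} ≤ vol(BZ)` for `t ≤ 1` and `≤ Csh t^{-1/γ}` for `t > 1`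
  have hbound : ∀ t ∈ Ioi (0 : ℝ), P {p | t < f p} ≤
      (Ioc (0 : ℝ) 1).indicator (fun _ => volume brillouinZone) t +
        (Ioi (1 : ℝ)).indicator (fun t => ENNReal.ofReal (Csh * t ^ (-γ⁻¹))) t := by
    intro t ht
    have ht0 : (0 : ℝ) < t := ht
    by_cases ht1 : t ≤ 1
    · rw [indicator_of_mem (show t ∈ Ioc (0 : ℝ) 1 from ⟨ht0, ht1⟩),
        indicator_of_notMem (fun h : t ∈ Ioi (1 : ℝ) => not_lt.2 ht1 h)]
      rw [add_zero]
      calc P {p | t < f p} ≤ P univ := measure_mono (subset_univ _)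
        _ = volume brillouinZone := by rw [hP, Measure.restrict_apply_univ]
    · rw [indicator_of_notMem (fun h : t ∈ Ioc (0 : ℝ) 1 => ht1 h.2),
        indicator_of_mem (show t ∈ Ioi (1 : ℝ) from not_le.1 ht1), zero_add]
      have hsubset : {p | t < f p} ⊆ {p : Momentum | |squareDispersion 1 0 p - μ| < t ^ (-γ⁻¹)} := by
        intro p (hpt : t < f p)
        show |squareDispersion 1 0 p - μ| < t ^ (-γ⁻¹)
        by_contra hge
        have hge : t ^ (-γ⁻¹) ≤ |squareDispersion 1 0 p - μ| := not_lt.1 hge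
        have htpow : 0 < t ^ (-γ⁻¹) := Real.rpow_pos_of_pos ht0 _
        have : f p ≤ t := by
          rw [hf]
          calc |squareDispersion 1 0 p - μ| ^ (-γ) ≤ (t ^ (-γ⁻¹)) ^ (-γ) :=
                Real.rpow_le_rpow_of_nonpos htpow hge (by linarith)
            _ = t := by rw [← Real.rpow_mul ht0.le]; field_simp; exact Real.rpow_one t
        linarith
      calc P {p | t < f p} ≤ P {p : Momentum | |squareDispersion 1 0 p - μ| < t ^ (-γ⁻¹)} := measure_mono hsubset
        _ = volume (brillouinZone ∩ {p : Momentum | |squareDispersion 1 0 p - μ| < t ^ (-γ⁻¹)}) := by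
            rw [hP, Measure.restrict_apply (measurableSet_lt ham measurable_const), inter_comm]
        _ ≤ ENNReal.ofReal (Csh * t ^ (-γ⁻¹)) := hSV _ (Real.rpow_pos_of_pos ht0 _)
  have hexp : -γ⁻¹ < -1 := by
    rw [neg_lt_neg_iff]; exact one_lt_inv₀ hγ0 |>.2 hγ1
  calc ∫⁻ t in Ioi 0, P {p | t < f p}
      ≤ ∫⁻ t in Ioi 0, ((Ioc (0 : ℝ) 1).indicator (fun _ => volume brillouinZone) t +
          (Ioi (1 : ℝ)).indicator (fun t => ENNReal.ofReal (Csh * t ^ (-γ⁻¹))) t) :=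
        setLIntegral_mono' measurableSet_Ioi hbound
    _ ≤ volume brillouinZone + ENNReal.ofReal (Csh * (γ⁻¹ - 1)⁻¹) := by
        rw [lintegral_add_left (Measurable.indicator measurable_const measurableSet_Ioc)]
        refine add_le_add ?_ ?_
        · rw [lintegral_indicator measurableSet_Ioc, setLIntegral_const]
          calc volume brillouinZone * (volume.restrict (Ioi (0 : ℝ))) (Ioc 0 1)
              ≤ volume brillouinZone * 1 := by
                refine mul_le_mul_right ((Measure.restrict_apply_le _ _).trans ?_) _
                rw [Real.volume_Ioc]; simp
            _ = volume brillouinZone := mul_one _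
        · rw [lintegral_indicator measurableSet_Ioi, Measure.restrict_restrict measurableSet_Ioi,
            inter_eq_left.2 (Ioi_subset_Ioi zero_le_one)]
          have hint : IntegrableOn (fun t : ℝ => Csh * t ^ (-γ⁻¹)) (Ioi 1) :=
            (integrableOn_Ioi_rpow_of_lt hexp zero_lt_one).const_mul Csh
          rw [← ofReal_integral_eq_lintegral_ofReal hint]
          · refine ENNReal.ofReal_le_ofReal (le_of_eq ?_)
            rw [integral_const_mul, integral_Ioi_rpow_of_lt hexp zero_lt_one, Real.one_rpow]
            have hne : -γ⁻¹ + 1 ≠ 0 := by linarith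
            have hne' : γ⁻¹ - 1 ≠ 0 := by linarith
            rw [show -γ⁻¹ + 1 = -(γ⁻¹ - 1) by ring, div_neg, neg_div, neg_neg, one_div]
          · exact (ae_restrict_iff' measurableSet_Ioi).2 (Eventually.of_forall fun t ht => by
              have : 0 ≤ t ^ (-γ⁻¹) := Real.rpow_nonneg (zero_le_one.trans (le_of_lt ht)) _
              positivity)

/-- **`∫_{BZ} |ε_p - μ|^{-γ} dp < ∞`** for `0 < γ < 1`, given the shell-volume estimate. [folklore] -/
theorem lintegral_rpow_neg_energy_lt_top {μ γ Csh : ℝ} (hγ0 : 0 < γ) (hγ1 : γ < 1) (hCsh : 0 ≤ Csh)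
    (hSV : ∀ t : ℝ, 0 < t →
      volume (brillouinZone ∩ {p : Momentum | |squareDispersion 1 0 p - μ| < t}) ≤ ENNReal.ofReal (Csh * t))
    (hBZ : volume brillouinZone ≠ ⊤) :
    ∫⁻ p in brillouinZone, ENNReal.ofReal (|squareDispersion 1 0 p - μ| ^ (-γ)) < ⊤ :=
  (lintegral_rpow_neg_energy_le hγ0 hγ1 hCsh hSV).trans_lt
    (ENNReal.add_lt_top.2 ⟨hBZ.lt_top, ENNReal.ofReal_lt_top⟩)

/-! ### (K1'): the polar Lindhard kernel is in `L²(dθ dθ')` -/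

section K1

variable {μ : ℝ} (hμ₁ : -4 < μ) (hμ₂ : μ < 0)
include hμ₁ hμ₂

/-- The `dp`-integral of the polar Lindhard integrand is a.e.-strongly measurable in `(θ, θ')`.
[folklore] -/
theorem aestronglyMeasurable_integral_lindhardIntegrand_polar :
    AEStronglyMeasurable (fun z : ℝ × ℝ => ∫ p in brillouinZone,
        lindhardIntegrand (squareDispersion 1 0) μ (fermiPolar μ z.1 + fermiPolar μ z.2) p)
      ((volume.restrict (Ioc (-π) π)).prod (volume.restrict (Ioc (-π) π))) := by
  have hsm : StronglyMeasurable (Function.uncurry fun (z : ℝ × ℝ) (p : Momentum) =>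
      lindhardIntegrand (squareDispersion 1 0) μ (fermiPolar μ z.1 + fermiPolar μ z.2) p) :=
    (measurable_lindhardIntegrand_polar hμ₁ hμ₂).stronglyMeasurable
  have h := StronglyMeasurable.integral_prod_right (ν := volume.restrict brillouinZone) hsm
  exact h.aestronglyMeasurable

/-- **`∫_{BZ} ‖F(γθ+γθ', p)‖_{L²(dθdθ')} dp < ∞`** given (TSL) uniformly in `p` and (SV) at level `μ`
(the section bound `eLpNorm_lindhardIntegrand_polar_le` off the null Fermi level set, then
`lintegral_rpow_neg_energy_lt_top`). [folklore] -/
theorem lintegral_eLpNorm_lindhardIntegrand_polar_lt_top {C β Csh : ℝ} (hC : 0 ≤ C) (hβ0 : 0 < β) (hβ2 : β < 2)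
    (hCsh : 0 ≤ Csh)
    (hTSL : ∀ (p : Momentum) (s : ℝ), 0 < s →
      ((volume.restrict (Ioc (-π) π)).prod (volume.restrict (Ioc (-π) π)))
        {z : ℝ × ℝ | |squareDispersion 1 0 (p + (fermiPolar μ z.1 + fermiPolar μ z.2)) - μ| < s} ≤
        ENNReal.ofReal (C * s ^ β))
    (hSV : ∀ t : ℝ, 0 < t →
      volume (brillouinZone ∩ {p : Momentum | |squareDispersion 1 0 p - μ| < t}) ≤ ENNReal.ofReal (Csh * t)) :
    ∫⁻ p in brillouinZone, eLpNorm (fun z : ℝ × ℝ =>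
        lindhardIntegrand (squareDispersion 1 0) μ (fermiPolar μ z.1 + fermiPolar μ z.2) p) 2
      ((volume.restrict (Ioc (-π) π)).prod (volume.restrict (Ioc (-π) π))) < ⊤ := by
  set ν : Measure (ℝ × ℝ) := (volume.restrict (Ioc (-π) π)).prod (volume.restrict (Ioc (-π) π)) with hν
  set P : Measure Momentum := volume.restrict brillouinZone with hP
  set K : ℝ := Real.sqrt (2 * C / (2 - β)) with hK
  have hae : ∀ᵐ p ∂P, eLpNorm (fun z : ℝ × ℝ =>
      lindhardIntegrand (squareDispersion 1 0) μ (fermiPolar μ z.1 + fermiPolar μ z.2) p) 2 ν ≤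
      ENNReal.ofReal (K * |squareDispersion 1 0 p - μ| ^ (β / 2 - 1)) := by
    have hnull : ∀ᵐ p ∂P, squareDispersion 1 0 p ≠ μ := by
      rw [hP]
      refine ae_restrict_of_ae ?_
      rw [ae_iff]
      simp only [not_not]
      exact volume_levelSet_squareDispersion μ
    filter_upwards [hnull] with p hp
    exact eLpNorm_lindhardIntegrand_polar_le hμ₁ hμ₂ p hC hβ2 (hTSL p) hp
  have hfin : ∫⁻ p, ENNReal.ofReal (K * |squareDispersion 1 0 p - μ| ^ (β / 2 - 1)) ∂P < ⊤ := by
    have hK0 : 0 ≤ K := Real.sqrt_nonneg _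
    have hrw : ∀ p, ENNReal.ofReal (K * |squareDispersion 1 0 p - μ| ^ (β / 2 - 1)) =
        ENNReal.ofReal K * ENNReal.ofReal (|squareDispersion 1 0 p - μ| ^ (-(1 - β / 2))) := fun p => by
      rw [← ENNReal.ofReal_mul hK0]
      congr 2
      rw [show -(1 - β / 2) = β / 2 - 1 by ring]
    simp_rw [hrw]
    rw [lintegral_const_mul _ (by
      have hε : Continuous (squareDispersion 1 0) := by unfold squareDispersion; fun_prop
      exact ENNReal.measurable_ofReal.comp (((hε.sub continuous_const).abs.measurable).pow_const _))]
    refine ENNReal.mul_lt_top ENNReal.ofReal_lt_top ?_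
    exact lintegral_rpow_neg_energy_lt_top (γ := 1 - β / 2) (by linarith) (by linarith) hCsh hSV
      volume_brillouinZone_lt_top.ne
  exact (lintegral_mono_ae hae).trans_lt hfin

/-- **(K1') The polar Lindhard kernel `(θ, θ') ↦ χ₀(γθ + γθ'; μ)` lies in `L²(dθ dθ' ⌞ (-π,π]²)`**,
given the torus sublevel estimate (TSL, uniformly in `p`) and the shell-volume estimate (SV) at
level `μ`. Minkowski's integral inequality (tree `MinkowskiIntegral`) +
`lintegral_eLpNorm_lindhardIntegrand_polar_lt_top`. [cite: SteinSingularIntegrals1970, App. A.1] -/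
theorem memLp_lindhardKernelPolar {C β Csh : ℝ} (hC : 0 ≤ C) (hβ0 : 0 < β) (hβ2 : β < 2) (hCsh : 0 ≤ Csh)
    (hTSL : ∀ (p : Momentum) (s : ℝ), 0 < s →
      ((volume.restrict (Ioc (-π) π)).prod (volume.restrict (Ioc (-π) π)))
        {z : ℝ × ℝ | |squareDispersion 1 0 (p + (fermiPolar μ z.1 + fermiPolar μ z.2)) - μ| < s} ≤
        ENNReal.ofReal (C * s ^ β))
    (hSV : ∀ t : ℝ, 0 < t →
      volume (brillouinZone ∩ {p : Momentum | |squareDispersion 1 0 p - μ| < t}) ≤ ENNReal.ofReal (Csh * t)) :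
    MemLp (fun z : ℝ × ℝ => lindhardFunction (squareDispersion 1 0) μ (fermiPolar μ z.1 + fermiPolar μ z.2)) 2
      ((volume.restrict (Ioc (-π) π)).prod (volume.restrict (Ioc (-π) π))) := by
  set ν : Measure (ℝ × ℝ) := (volume.restrict (Ioc (-π) π)).prod (volume.restrict (Ioc (-π) π)) with hν
  set P : Measure Momentum := volume.restrict brillouinZone with hP
  -- the unnormalised kernel `g(z) = ∫_{BZ} F(γθ+γθ', p) dp`
  set g : ℝ × ℝ → ℝ := fun z => ∫ p in brillouinZone,
    lindhardIntegrand (squareDispersion 1 0) μ (fermiPolar μ z.1 + fermiPolar μ z.2) p with hg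
  have hgm : AEStronglyMeasurable g ν := aestronglyMeasurable_integral_lindhardIntegrand_polar hμ₁ hμ₂
  -- Minkowski
  have hMink : eLpNorm g 2 ν ≤ ∫⁻ p, eLpNorm (fun z : ℝ × ℝ =>
      lindhardIntegrand (squareDispersion 1 0) μ (fermiPolar μ z.1 + fermiPolar μ z.2) p) 2 ν ∂P := by
    have hF : AEStronglyMeasurable (Function.uncurry fun (z : ℝ × ℝ) (p : Momentum) =>
        lindhardIntegrand (squareDispersion 1 0) μ (fermiPolar μ z.1 + fermiPolar μ z.2) p) (ν.prod P) :=
      (measurable_lindhardIntegrand_polar hμ₁ hμ₂).aestronglyMeasurable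
    exact Literature.Analysis.FunctionSpaces.eLpNorm_integral_le_lintegral_eLpNorm hF (p := 2)
      (by norm_num) ENNReal.ofNat_ne_top
  have hg2 : MemLp g 2 ν :=
    ⟨hgm, hMink.trans_lt (lintegral_eLpNorm_lindhardIntegrand_polar_lt_top hμ₁ hμ₂ hC hβ0 hβ2 hCsh hTSL hSV)⟩
  -- `χ₀ = (2π)⁻² g`
  have hfun : (fun z : ℝ × ℝ => lindhardFunction (squareDispersion 1 0) μ (fermiPolar μ z.1 + fermiPolar μ z.2)) =
      fun z => ((2 * π) ^ 2)⁻¹ * g z := by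
    funext z
    simp only [lindhardFunction, hg]
    rw [div_eq_inv_mul]
  rw [hfun]
  exact hg2.const_mul _

end K1

end Literature.MathematicalPhysics.QuantumLattice

end
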